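import Summits.QuantumFields.BalabanUV.Beta.WardLocusSymShift
import Summits.QuantumFields.BalabanUV.Beta.KernelWardMColumn

/-!
# `BalabanUV.Beta.WardLocusSymSockets` — binder row D1, SECOND-ORDER hW (W-side) of the (0.4) literal «JsB12Sym»: THE RESOLVENT SOCKETS OF THE
# SYMMETRISED CO-DRESSED STEP RESOLVENTS `Gsym Lc j = coDressKSymAt ρ_c Lc (KInvStep Lc j)` that the slot-generic second-order Ward chain
# (`WardLocusRecursiveStepSlot` ∕ `WardLocusQuarticTableSlot` ∕ `WardLocusRecursiveAllSlot`) consumes beyond those already in the tree — the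
# multiplier-column Ward law (hMw), the off-lattice vanishing of the multiplier rows (hoff), and the FIRST-ORDER law (hD) of the unfolded vertex
# `dM (Gsym j) Lc (SpureSymOf tabs … j) (tabs.M j)` against the shifted spread `bhKStepSh d Lc Dsh j` from the border letter (V-d)
# (β sub-cell, BINDER-OWNERS row D1 OWNER `b2b-balaban-beta-an2`, gen 29; INTENT «SYM-hW-SECOND-ORDER» journal [AN2-G29-ONLINE])

HONEST FRAMING (cell charter, verbatim): «discharging BetaPertH makes Bałaban's UV stability UNCONDITIONAL — a real constructive-QFT result; it is
NOT the continuum limit and NOT the Clay problem.»  HONEST DEPENDENCY: continuum YM on T⁴ ⇐ BetaPertH ∧ nine spine estimates (0/9 proved);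
BetaPertH ⇐ (D1) ∧ (D4) ∧ CAP+tail; G-an2-4 gates asym, D1 and NE2/3/4.
NOT IN PRINT; OUR BOOKKEEPING.  [folklore] kernel algebra over tree objects BY NAME: `SymShiftedSpread.coDressKSymAt_inr_inr` (the symmetrised co-dressing does
not touch the multiplier block), `KernelWardMColumn.colM_KInvStep_ward`, `OneStepKernelFamily.KInvStep_inr_off`, an1's `KernelWardMColumn.divV_dM_eq_conjV`, g28's
`WardLocusSymShift.hSd_SrecOf_Gsym_bhKStepSh_all_pins`, leaf-05's `RecursiveStencilSlot.divV_SrecOf_succ` ∕ g28's `WardLocusSymShift.divV_S0NOf` (the Λ-sector is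
divergence-free), `KernelWardHColumnSym.colH_ward_coDressKSymAt_KInvStep`.  The border letter (V-d) of the shift `Dsh` (≡ an1's table Ward law (S-V)⁰⁴ by
`DshAn1.hVd_iff`) is a DISPLAYED HYPOTHESIS; no statement of Bałaban's papers, no `[cite:]`, no `def`, no `def … : Prop`; instantiates NO binder of the
β-function wall.  NOT hW, NOT D1, NOT `BetaPertH`, NOT continuum, NOT Clay.

* §1 (hMw)(hoff) for `Gsym`: `colM_Gsym` (`= colM (KInvStep Lc j)`), **`colM_Gsym_ward`**, `colM_Gsym_ward_resp`, **`Gsym_inr_inr_off`**.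
* §2 THE PURE TABLES HAVE THE DIVERGENCE OF THE FOLDED ONES (slot-generic): **`divV_SpureRecOf_eq_divV_SrecOf`** (`∀ j u`); hence the (Sd) law of the pure
  tables of the literal at the pins against the shifted spread: **`hSd_SpureRecOf_Gsym_bhKStepSh_all_pins`**, **`hSd_SpureSymOf_all`**.
* §3 **(hD) FOR THE LITERAL: `divV_dM_SpureSymOf_eq_conjV`** — `divV (dM (Gsym Lc j) Lc (SpureSymOf tabs Lc^{d+1} (−Lc^{d+1}·½·Lc^{d+1}) cΛ j) (tabs.M j)) y
  = conjV (bhKStepSh d Lc Dsh j) (diagK (½ • Σ_v legInd ρ_c (Lc•y+v)))`, every `j`, under (Dspr)(Dnull)(V-d) only.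
Provenance: β sub-cell, unit beta-an2 gen 29, 2026-08-21 (v1); over the files named above BY NAME; no existing file touched.
-/

noncomputable section

open Finset
open scoped BigOperators
open Literature.MathematicalPhysics.QuantumFieldTheory
open Literature.MathematicalPhysics.QuantumFieldTheory.Balaban1983to89
open Literature.MathematicalPhysics.QuantumFieldTheory.Balaban1983to89.Beta
open B6BondElimination (unitVec)
open ExpKernelCalculus (MKer Decays BiLoc VertexFamily comp)
open KernelWard (divV bdd_of_biLoc)
open AffineAveraging (Site box toSite)
open AveragingContoursRooted (ctr ctrOff ctrOff_mem_box)
open OneStepResolventKernel (Fib LocStencil)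
open OneStepKernelFamily (KInvStep KInvStep_inr_off colH vertexOfK)
open BalabanStepJetsSucc (wE wVH)
open SecondOrderResponse (colM vertexOfM dM)
open StepJetData (wilsonA)
open Summit.QuantumFields.BalabanUV.Beta.TameKernelCalculus
open Summit.QuantumFields.BalabanUV.Beta.ChartConjugation (conjV)
open Summit.QuantumFields.BalabanUV.Beta.AxialDressingRooted (one_le_of_neZero)
open Summit.QuantumFields.BalabanUV.Beta.BorderedHessian (bhK stepScale diagK)
open Summit.QuantumFields.BalabanUV.Beta.AveragingWardRootedStencils (legInd)
open Summit.QuantumFields.BalabanUV.Beta.WardLocusStencils (ffK divV_apply)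
open Summit.QuantumFields.BalabanUV.Beta.WardLocusCubic (e3K)
open Summit.QuantumFields.BalabanUV.Beta.WardLocusRecursive (SrecOf SrecOf_zero e3OfK_eq_e3K)
open Summit.QuantumFields.BalabanUV.Beta.SpineRooted (S0NOf SpureRecOf SpureRecOf_zero_level SpureRecOf_succ divV_SrecOf_succ)
open Summit.QuantumFields.BalabanUV.Beta.SymSliceProjectorKernel (symEc)
open Summit.QuantumFields.BalabanUV.Beta.KernelWardHColumnSym (colH_ward_coDressKSymAt_KInvStep)
open Summit.QuantumFields.BalabanUV.Beta.KernelWardMColumn (colM_KInvStep_ward colM_KInvStep_ward_resp divV_dM_eq_conjV)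
open Summit.QuantumFields.BalabanUV.Beta.SymmetrisedStepJets (SymTables Gsym Gsym_apply decays_Gsym SsymOf SsymOf_eq SpureSymOf locStencil_SpureSymOf)
open Summit.QuantumFields.BalabanUV.Beta.SymShiftedSpread (bhKStepSh coDressKSymAt_inr_inr)
open Summit.QuantumFields.BalabanUV.Beta.WardLocusSymShift (divV_S0NOf hSd_SrecOf_Gsym_bhKStepSh_all_pins)

namespace Summit.QuantumFields.BalabanUV.Beta.WardLocusSymSockets

variable {d : ℕ}

/-! ## §1 (hMw)(hoff): the multiplier block of `Gsym` is the straight step propagator's -/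

section Multiplier

variable {Lc : ℕ} [NeZero Lc]

/-- [folklore] **THE SYMMETRISED CO-DRESSING DOES NOT TOUCH THE MULTIPLIER COLUMNS**: `colM (Gsym Lc j) Lc μ y ρ w = colM (KInvStep Lc j) Lc μ y ρ w`
(`SymShiftedSpread.coDressKSymAt_inr_inr`; twin of `KernelWardMColumn.colM_coDressKBmAt`). -/
theorem colM_Gsym (j : ℕ) (μ : Fin (d + 1)) (y : Fin (d + 1) → ℤ) (ρ : Fin (d + 1)) (w : Fin (d + 1) → ℤ) :
    colM (Gsym (d := d) Lc j) Lc μ y ρ w = colM (KInvStep (d := d) Lc j) Lc μ y ρ w := by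
  simp only [colM, Gsym_apply, coDressKSymAt_inr_inr]

/-- [folklore] **(hMw) FOR `Gsym`: THE MULTIPLIER-COLUMN WARD LAW, SOURCE SLOT, EVERY LEVEL** (`KernelWardMColumn.colM_KInvStep_ward` through `colM_Gsym`). -/
theorem colM_Gsym_ward (j : ℕ) (y : Fin (d + 1) → ℤ) (ρ : Fin (d + 1)) (w : Fin (d + 1) → ℤ) :
    ∑ μ, (colM (Gsym (d := d) Lc j) Lc μ (y - unitVec μ) ρ w - colM (Gsym (d := d) Lc j) Lc μ y ρ w) = 0 := by
  simp only [colM_Gsym]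
  exact colM_KInvStep_ward j y ρ w

/-- [folklore] (hMw, response slot) for `Gsym` (`KernelWardMColumn.colM_KInvStep_ward_resp` through `colM_Gsym`). -/
theorem colM_Gsym_ward_resp (j : ℕ) (μ : Fin (d + 1)) (y w : Fin (d + 1) → ℤ) :
    ∑ ρ, (colM (Gsym (d := d) Lc j) Lc μ y ρ (w - unitVec ρ) - colM (Gsym (d := d) Lc j) Lc μ y ρ w) = 0 := by
  simp only [colM_Gsym]
  exact colM_KInvStep_ward_resp j μ y w

/-- [folklore] **(hoff) FOR `Gsym`: THE MULTIPLIER ROWS VANISH OFF THE COARSE LATTICE** (`coDressKSymAt_inr_inr` + `OneStepKernelFamily.KInvStep_inr_off`;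
twin of `KernelWardResponse.coDressKBmAt_KInvStep_inr_inr_off`). -/
theorem Gsym_inr_inr_off (j : ℕ) (x : Fin (d + 1) → ℤ) (hx : Literature.Probability.LatticeModels.Torus.proj Lc x ≠ 0) (z : Fin (d + 1) → ℤ)
    (ρ μ : Fin (d + 1)) : Gsym (d := d) Lc j x z (Sum.inr ρ) (Sum.inr μ) = 0 := by
  rw [Gsym_apply, coDressKSymAt_inr_inr]
  exact KInvStep_inr_off j hx ρ (Sum.inr μ) z

end Multiplier

/-! ## §2 The pure tables have the divergence of the folded ones; their (Sd) law at the pins against the shifted spread -/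

section Pure

variable {Lc : ℕ} [NeZero Lc]
variable {V H : Fin (d + 1) → (Fin (d + 1) → ℤ) → MKer (d + 1) (Fib d)} {G : ℕ → MKer (d + 1) (Fib d)}

/-- [folklore] **THE Λ-SECTOR IS DIVERGENCE-FREE, SO `divV (SpureRecOf … j) u = divV (SrecOf … j) u` AT EVERY LEVEL** (slot-generic; (LH) at every rate):
level `0` by g28's `WardLocusSymShift.divV_S0NOf`, level `j+1` by leaf-05's `RecursiveStencilSlot.divV_SrecOf_succ`, plus linearity of `divV`. -/
theorem divV_SpureRecOf_eq_divV_SrecOf (hH : ∀ δ : ℝ, 0 ≤ δ → ∃ C : ℝ, VertexFamily H Lc C δ) (cE cVH cΛ : ℝ) :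
    ∀ (j : ℕ) (u : Fin (d + 1) → ℤ), divV (SpureRecOf d Lc V H G cE cVH cΛ j) u = divV (SrecOf d Lc V H G cE cVH cΛ j) u
  | 0, u => by
    rw [SrecOf_zero, divV_S0NOf hH, SpureRecOf_zero_level]
    funext x z a b
    simp only [divV_apply, Pi.add_apply, Pi.smul_apply, smul_eq_mul, Finset.sum_add_distrib, Finset.sum_sub_distrib, ← Finset.mul_sum]
    ring
  | j + 1, u => by
    have hH1 : ∃ C δ : ℝ, 0 < δ ∧ VertexFamily H Lc C δ := by
      obtain ⟨C, hC⟩ := hH 1 zero_le_one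
      exact ⟨C, 1, one_pos, hC⟩
    rw [divV_SrecOf_succ hH1 cE cVH cΛ j u, SpureRecOf_succ, ← e3OfK_eq_e3K]
    funext x z a b
    simp only [divV_apply, Pi.add_apply, Pi.smul_apply, smul_eq_mul, Finset.sum_add_distrib, Finset.sum_sub_distrib, ← Finset.mul_sum]
    ring

/-- [folklore] **(Sd) FOR THE PURE TABLES `SpureRecOf V H Gsym` AT THE PINS AGAINST THE SHIFTED SPREAD**, every level: g28's
`hSd_SrecOf_Gsym_bhKStepSh_all_pins` read through `divV_SpureRecOf_eq_divV_SrecOf` — under (LV)(LH), (Dspr)(Dnull) and the border letter (V-d). -/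
theorem hSd_SpureRecOf_Gsym_bhKStepSh_all_pins (hV : ∀ δ : ℝ, 0 ≤ δ → ∃ C : ℝ, LocStencil V C δ)
    (hH : ∀ δ : ℝ, 0 ≤ δ → ∃ C : ℝ, VertexFamily H Lc C δ) {Dsh : MKer (d + 1) (Fib d)} (hD : Spr Dsh)
    (hDnull : comp (comp (symEc Lc) Dsh) (symEc Lc) = 0)
    (hVd : ∀ u : Fin (d + 1) → ℤ, conjV (bhK Lc + Dsh) (diagK (legInd (ctr (d + 1) Lc) u)) =
      conjV (ffK (bhK (d := d) Lc)) (diagK (legInd (ctr (d + 1) Lc) u)) - ((Lc : ℝ) ^ (d + 1)) • divV V u)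
    (cΛ : ℝ) (j : ℕ) (y : Fin (d + 1) → ℤ) :
    (stepScale d Lc j * (Lc : ℝ) ^ (d + 1))⁻¹ • ∑ v ∈ box (d + 1) Lc,
        divV (SpureRecOf d Lc V H (Gsym Lc) ((Lc : ℝ) ^ (d + 1)) (-((Lc : ℝ) ^ (d + 1) * (1 / 2) * (Lc : ℝ) ^ (d + 1))) cΛ j) ((Lc : ℤ) • y + toSite v) =
      conjV (bhKStepSh d Lc Dsh j) (diagK ((1 / 2 : ℝ) • ∑ v ∈ box (d + 1) Lc, legInd (ctr (d + 1) Lc) ((Lc : ℤ) • y + toSite v))) := by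
  simp only [divV_SpureRecOf_eq_divV_SrecOf hH]
  exact hSd_SrecOf_Gsym_bhKStepSh_all_pins hV hH hD hDnull hVd cΛ j y

/-- [folklore] **(Sd) FOR THE LITERAL's PURE TABLES `SpureSymOf tabs`** at the pins against `bhKStepSh d Lc Dsh j`, every level, under (Dspr)(Dnull)(V-d). -/
theorem hSd_SpureSymOf_all (tabs : SymTables d Lc) {Dsh : MKer (d + 1) (Fib d)} (hD : Spr Dsh) (hDnull : comp (comp (symEc Lc) Dsh) (symEc Lc) = 0)
    (hVd : ∀ u : Fin (d + 1) → ℤ, conjV (bhK Lc + Dsh) (diagK (legInd (ctr (d + 1) Lc) u)) =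
      conjV (ffK (bhK (d := d) Lc)) (diagK (legInd (ctr (d + 1) Lc) u)) - ((Lc : ℝ) ^ (d + 1)) • divV tabs.V u)
    (cΛ : ℝ) (j : ℕ) (y : Fin (d + 1) → ℤ) :
    (stepScale d Lc j * (Lc : ℝ) ^ (d + 1))⁻¹ • ∑ v ∈ box (d + 1) Lc,
        divV (SpureSymOf tabs ((Lc : ℝ) ^ (d + 1)) (-((Lc : ℝ) ^ (d + 1) * (1 / 2) * (Lc : ℝ) ^ (d + 1))) cΛ j) ((Lc : ℤ) • y + toSite v) =
      conjV (bhKStepSh d Lc Dsh j) (diagK ((1 / 2 : ℝ) • ∑ v ∈ box (d + 1) Lc, legInd (ctr (d + 1) Lc) ((Lc : ℤ) • y + toSite v))) :=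
  hSd_SpureRecOf_Gsym_bhKStepSh_all_pins tabs.hV tabs.hH hD hDnull hVd cΛ j y

end Pure

/-! ## §3 (hD) for the literal: the first-order Ward law of the unfolded vertex `dM (Gsym j) Lc (SpureSymOf … j) (tabs.M j)` -/

section FirstOrder

variable {Lc : ℕ} [NeZero Lc]

/-- [folklore] **(hD) FOR THE (0.4) LITERAL, EVERY LEVEL** (generic `d`, the pins of record `(cE, cVH) = (Lc^{d+1}, −Lc^{d+1}·½·Lc^{d+1})`): under (Dspr)(Dnull)
and the border letter (V-d) of the shift `Dsh`,
`divV (dM (Gsym Lc j) Lc (SpureSymOf tabs … j) (tabs.M j)) y = conjV (bhKStepSh d Lc Dsh j) (diagK (½ • Σ_v legInd ρ_c (Lc•y+v)))` —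
an1's `divV_dM_eq_conjV` fed with (hMw) `colM_Gsym_ward`, (hH) `colH_ward_coDressKSymAt_KInvStep`, §2's (Sd) law of the pure tables and (LM). -/
theorem divV_dM_SpureSymOf_eq_conjV (tabs : SymTables d Lc) {Dsh : MKer (d + 1) (Fib d)} (hD : Spr Dsh)
    (hDnull : comp (comp (symEc Lc) Dsh) (symEc Lc) = 0)
    (hVd : ∀ u : Fin (d + 1) → ℤ, conjV (bhK Lc + Dsh) (diagK (legInd (ctr (d + 1) Lc) u)) =
      conjV (ffK (bhK (d := d) Lc)) (diagK (legInd (ctr (d + 1) Lc) u)) - ((Lc : ℝ) ^ (d + 1)) • divV tabs.V u)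
    (cΛ : ℝ) (j : ℕ) (y : Fin (d + 1) → ℤ) :
    divV (dM (Gsym Lc j) Lc (SpureSymOf tabs ((Lc : ℝ) ^ (d + 1)) (-((Lc : ℝ) ^ (d + 1) * (1 / 2) * (Lc : ℝ) ^ (d + 1))) cΛ j) (tabs.M j)) y =
      conjV (bhKStepSh d Lc Dsh j) (diagK ((1 / 2 : ℝ) • ∑ v ∈ box (d + 1) Lc, legInd (ctr (d + 1) Lc) ((Lc : ℤ) • y + toSite v))) := by
  have hLc : 1 ≤ Lc := one_le_of_neZero Lc
  obtain ⟨Cs, δs, hδs, hS⟩ := locStencil_SpureSymOf tabs ((Lc : ℝ) ^ (d + 1)) (-((Lc : ℝ) ^ (d + 1) * (1 / 2) * (Lc : ℝ) ^ (d + 1))) cΛ j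
  obtain ⟨CM, δM, hδM, hM⟩ := tabs.hM j
  have hMb : ∀ ρ w x z a b, |tabs.M j ρ w x z a b| ≤ CM := fun ρ w x z a b => bdd_of_biLoc (hM ρ w) hδM.le x z a b
  exact divV_dM_eq_conjV (decays_Gsym Lc j) hLc (fun y ρ w => colM_Gsym_ward (d := d) (Lc := Lc) j y ρ w) hS hδs
    ((stepScale d Lc j * (Lc : ℝ) ^ (d + 1))⁻¹) (fun y κ' u => colH_ward_coDressKSymAt_KInvStep (d := d) (Lc := Lc) j y κ' u)
    (fun y => hSd_SpureSymOf_all tabs hD hDnull hVd cΛ j y) hMb y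

end FirstOrder

end Summit.QuantumFields.BalabanUV.Beta.WardLocusSymSockets

end
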